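import Summits.BirchSwinnertonDyer.Rank1Residual.X1.ResidualDescentInjective
import Literature.NumberTheory.EllipticCurves.IwasawaTowerTorsionOrdinaryProofs
import Literature.NumberTheory.GaloisRepresentations.DecompositionGroupOfCompletion
import HarnessLib

/-!
# Route D, step (a) for the LAYERS of the cyclotomic `ℤ_p`-extension of `ℚ`: a Greenberg–Selmer class
# over `ℚ_n` in the local kernel at `p` that dies over `ℚ_∞` is zero (X1R0-GAPMAP §17.1 (a))

HONEST FRAMING (cell `b2b-bsdres`, run/shared/lean/b2b/bsd-rank1-residual/, verbatim in every
file): the goal of the cell is to DELETE the COMBINATION-SHAPED residual classes of the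
Birch–Swinnerton-Dyer formula for ALL analytic-rank `≤ 1` elliptic curves over `ℚ` — "full BSD
formula for every rank `≤ 1` curve in class `C`" assembled STRICTLY from published theorems — so
that the rank-`≤ 1` remainder becomes exactly the CONSTRUCTION-SHAPED classes, which are TYPED
(missing-input `Prop`s), NOT attempted. This is not "finishing BSD". Sub-cell
`b2b-bsdres-eisenstein-p1` (CLASS-OWNERS row "X1 (r=0)"), gen 8: research route; NO CLAIM BEYOND
STATED CLASSES; nothing here changes a label. THEOREMS ONLY.

WHAT THIS FILE PROVES. The specialisation of `ResidualDescentInjective.eq_zero_of_mem_greenbergKer_of_resOfLe_eq_zero`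
(p223821) to the situation of route D: `K = ℚ`, `κ` the CYCLOTOMIC `ℤ_p`-extension, `H' = κ.layerSubgroup n = Gal(ℚ̄/ℚ_n)`,
`H = κ.kerSubgroup = Gal(ℚ̄/ℚ_∞)`, `v` the place of `ℚ` at `p`. Of the three hypotheses of the general
theorem, (hgen) `Gal(ℚ̄/ℚ_n) = (Gal(ℚ̄/ℚ_n) ∩ I_p)·Gal(ℚ̄/ℚ_∞)` is DISCHARGED here from the tree's
total-ramification theorem `ZpExtension.IsCyclotomic.exists_mem_inertia_inv_mul_mem_kerSubgroup`
(`κ(I_𝔓) = ℤ_p`, `IwasawaTowerTorsionOrdinaryProofs`) and Neukirch II (9.6)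
(`inertia_adicCompletionPrime_eq_map_absInertia`: the tree's `GreenbergSelmer.inertia v` is `I_{𝔓₀}`);
normality of `Gal(ℚ̄/ℚ_∞)` is automatic (a kernel). There remain, as explicit hypotheses on the
discrete module `M` and the local datum `N`: (htriv) `I_p` acts trivially on `M ⧸ M⁺` and (hfix)
`M^{Gal(ℚ̄/ℚ_∞)} ∩ M⁺ = 0` — for `M = E₀[p]`, `M⁺ = Ê₀[p]` at a good ordinary `p` these are "`D` is
unramified" and "`E₀(ℚ_∞)[p]` (= `E₀(ℚ)[p]`, `mem_fixedPoints_kerSubgroup_iff_of_isCyclotomic`) misses the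
kernel of reduction" (Silverman VII.3.1).
**`eq_zero_of_mem_greenbergKer_layer_of_res_kerSubgroup_eq_zero`**: every `c ∈ H¹(Gal(ℚ̄/ℚ_n), M)`
in Greenberg's local kernel at `p` with `res_{ℚ_∞} c = 0` is `0` — the injectivity
`Sel_n(E₀[p]/ℚ_n) ↪ S^{Σ₀}_{E₀[p]}(ℚ_∞)` of route D (the witnesses over `ℚ_n` are counted faithfully in
Greenberg–Vatsal's residual Selmer group over `ℚ_∞`).

References: Greenberg (1989) §1 p. 98; Greenberg–Vatsal (2000) §2 p. 25; Washington §13.1;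
Neukirch, ANT II (7.13)(i), (9.6); HOME/b2b-bsdres-eisenstein-p1/X1R0-GAPMAP.md §17.1.
-/

noncomputable section

open scoped Classical

open NumberField IsDedekindDomain Field
open Literature.NumberTheory.EllipticCurves Literature.NumberTheory.EllipticCurves.GreenbergSelmer
  Literature.NumberTheory.GaloisRepresentations Rat.HeightOneSpectrum

universe u

namespace Summit.BirchSwinnertonDyer.Rank1Residual.X1.ResidualDescentInjective

variable {p : ℕ} [Fact p.Prime]
variable {M : Type} [AddCommGroup M] [DistribMulAction (absoluteGaloisGroup ℚ) M]
  [TopologicalSpace M] [DiscreteTopology M]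

/-- **Total ramification of `ℚ_∞/ℚ_n` at `p`, in the form (hgen):** for the cyclotomic `κ` and the
place `v` of `ℚ` at `p`, every `g ∈ Gal(ℚ̄/ℚ_n) = κ.layerSubgroup n` is `i·h` with `i` in the tree's
inertia group `GreenbergSelmer.inertia v` (`= I_{𝔓₀}`, Neukirch II (9.6)), `i ∈ Gal(ℚ̄/ℚ_n)`, and
`h = i⁻¹ g ∈ Gal(ℚ̄/ℚ_∞) = κ.kerSubgroup` (`κ(I_𝔓) = ℤ_p`, Washington §13.1).
[cite: Washington1997, §13.1] [cite: NeukirchANT1999, Ch. II §9 Prop. (9.6)] -/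
theorem exists_mem_inertia_mem_layer_inv_mul_mem_kerSubgroup {κ : ZpExtension ℚ p}
    (hκ : κ.IsCyclotomic) {v : HeightOneSpectrum (𝓞 ℚ)} (hv : (primesEquiv v : ℕ) = p) (n : ℕ)
    {g : absoluteGaloisGroup ℚ} (hg : g ∈ κ.layerSubgroup n) :
    ∃ i ∈ inertia v, i ∈ κ.layerSubgroup n ∧ i⁻¹ * g ∈ κ.kerSubgroup := by
  obtain ⟨τ, hτ, hk⟩ :=
    hκ.exists_mem_inertia_inv_mul_mem_kerSubgroup hv (adicCompletionPrime_mem_primesAbove ℚ v) g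
  refine ⟨τ, ?_, ?_, hk⟩
  · -- `I_{𝔓₀} = res(I_{ℚ_v})` is the tree's `inertia v`
    have hI : (adicCompletionPrime ℚ v).inertia (absoluteGaloisGroup ℚ) = inertia v := by
      rw [GreenbergSelmer.inertia]
      exact inertia_adicCompletionPrime_eq_map_absInertia ℚ v
    rw [← hI]
    exact hτ
  · -- `κ τ = κ g`, so `τ` lies in the same layer
    have hkg : κ τ = κ g := by
      rw [ZpExtension.mem_kerSubgroup, map_mul, map_inv, inv_mul_eq_one] at hk
      exact hk
    rw [ZpExtension.mem_layerSubgroup] at hg ⊢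
    rw [hkg]
    exact hg

/-- **Route D, step (a), for the cyclotomic layers.** `κ` cyclotomic, `v` the place at `p`, `N` an
ordinary local datum at `v` for the discrete `Γ_ℚ`-module `M` with (htriv) `I_v` trivial on `M ⧸ M⁺_v`
and (hfix) `M^{Gal(ℚ̄/ℚ_∞)} ∩ M⁺_v = 0`. Then every class `c ∈ H¹(Gal(ℚ̄/ℚ_n), M)` in Greenberg's local
kernel at `v` whose restriction to `Gal(ℚ̄/ℚ_∞)` vanishes is zero: the level-`n` witnesses of route D
inject into Greenberg–Vatsal's Selmer group over `ℚ_∞` (X1R0-GAPMAP §17.1 (a); for `M = E₀[p]`,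
`M⁺ = Ê₀[p]`: `D` unramified and `E₀(ℚ)[p] ∩ Ê₀ = 0`).
[cite: Greenberg1989, §1 p. 98 (4)] [cite: GreenbergVatsal2000, §2 p. 25] [cite: Washington1997, §13.1] -/
theorem eq_zero_of_mem_greenbergKer_layer_of_res_kerSubgroup_eq_zero {κ : ZpExtension ℚ p}
    (hκ : κ.IsCyclotomic) {v : HeightOneSpectrum (𝓞 ℚ)} (hv : (primesEquiv v : ℕ) = p) (n : ℕ)
    (N : LocalDatum ℚ M v)
    (htriv : ∀ i ∈ inertia v, ∀ m : M, i • m - m ∈ N.plus)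
    (hfix : ∀ m : M, (∀ h ∈ κ.kerSubgroup, h • m = m) → m ∈ N.plus → m = 0)
    {c : subgroupH1 (κ.layerSubgroup n) M} (hc : c ∈ N.greenbergKer (κ.layerSubgroup n))
    (hres : resOfLe M (κ.kerSubgroup_le_layerSubgroup n) c = 0) : c = 0 :=
  eq_zero_of_mem_greenbergKer_of_resOfLe_eq_zero (κ.kerSubgroup_le_layerSubgroup n)
    (fun g _ h hh ↦ by
      rw [ZpExtension.mem_kerSubgroup] at hh ⊢
      rw [map_mul, map_mul, map_inv, hh, mul_one, inv_mul_cancel])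
    N htriv hfix (fun g hg ↦ exists_mem_inertia_mem_layer_inv_mul_mem_kerSubgroup hκ hv n hg) hc hres

end Summit.BirchSwinnertonDyer.Rank1Residual.X1.ResidualDescentInjective

end
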